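import Mathlib
import Summits.PneNP.PneNP.Theorems.CnfIdealGenLengthRankDefectRepresentationsUniversalFrame
import Summits.PneNP.PneNP.Theorems.CnfIdealGenLengthRankDefectRepresentationsCoreReduction

/-!
# Crux `RankDefectRepresentations` (stmt-PneNP-18923), line `rank-dehn-ladder`: CORE-LINEAR ⟺ SIMULTANEOUS I-DIAGONAL
# CORRECTION (lead g13, memo `Cruxes/RankDefectRepresentations/Lines/rank-dehn-ladder-g13.md` §2, Theorem R)

Setting of the registered tool stub `stub_coreLinear` (two-family colourings `row`, `col`; `colourI`, `colourJ`, `doubleCut` of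
`…TwoFamilyCutDomination`): a matrix of small rank agreeing with `D` at the VISIBLE cells (both colours differ) is wanted.

The coherence problem behind the stub in its final form.  Call a matrix `Φ` an I-DIAGONAL CORRECTION if it is supported on the cells
whose I-colours agree (all of them invisible).  For a J-bipartition `B′` the DIRECTED J-CUT BLOCK of `D + Φ` is
`(D + Φ) ∘ 1[(J ∈ B′) × (J ∉ B′)]`.  Every single block is correctable to rank `≤ 8c` by SOME I-diagonal correction (this is g7's one-family
theorem in the form `…CoreReduction.exists_piece_rowsJ`, p680652).  THIS FILE:

* `completion_of_simCorr` — if ONE I-diagonal correction `Φ` makes EVERY directed J-cut block of `D + Φ` of rank `≤ λ`, then a matrix of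
  rank `≤ 8λ` agrees with `D` at all visible cells (g7's one-family max-cut decomposition for the J-colouring,
  `…UniversalFrame.exists_completion_le_four_jmaxcut`, applied to `D + Φ`; `Φ` vanishes at visible cells);
* `simCorr_of_completion` — conversely a completion `L` of rank `≤ λ` yields such a `Φ` (the I-diagonal, J-off-diagonal part of `L − D`)
  with all directed J-cut blocks of rank `≤ λ`.

Hence CORE-LINEAR (and the 2D max-cut decomposition with an absolute constant) is EQUIVALENT, instance by instance and up to the factor 8,
to SIMCORR: «the directed J-cut blocks, each correctable to rank O(c) on its I-diagonal cells, are correctable SIMULTANEOUSLY by one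
I-diagonal correction».  The abstract form (data `S_{B′}` on the region `B′ × B′ᶜ` of J-colour space, pairwise consistent on the one
common block `(B′∩B″) × (B′∪B″)ᶜ`, one `Φ` close to all) is the GLUE-dir problem of the memo; its Hamming and vertex-cover shadows glue by
majority vote, every data-oblivious linear gluing rule loses a factor `≥ (m−1)/4`, and whether the rank-metric version glues is exactly the
open question.  Nothing here proves the stub.
HONEST FRAMING: a reformulation (two short theorems); CORE-LINEAR, the crux and P ≠ NP are not touched; F-N2 is a FRONTIER formal rung.
-/

set_option linter.dupNamespace false -- `Summit.PneNP.PneNP.…`: summit = sub-problem name (D-0017)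

namespace Summit.PneNP.PneNP.Theorems.CnfIdealGenLengthRankDefectRepresentationsSimultaneousCorrection

open Finset Matrix
open Summit.PneNP.PneNP.Theorems.CnfIdealGenLengthRankDefectRepresentationsTwoFamilyCutDomination (colourI colourJ)
open Summit.PneNP.PneNP.Theorems.CnfIdealGenLengthRankDefectRepresentationsUniversalFrame (exists_completion_le_four_jmaxcut)
open Summit.PneNP.PneNP.Theorems.CnfIdealGenLengthRankDefectRepresentationsStripCompletion (rank_mask_le)

variable {K : Type} [Field K] {n n' : ℕ} {ι ι' : Type} [Fintype ι] [Fintype ι'] [DecidableEq ι] [DecidableEq ι']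

/-- **SIMCORR ⟹ completion.**  If `Φ` is an I-diagonal correction (zero wherever the I-colours differ) and every directed J-cut block of
`D + Φ` has rank `≤ λ`, then some matrix of rank `≤ 8λ` agrees with `D` at every visible cell. -/
theorem completion_of_simCorr (row : ι → Fin n ⊕ Fin n' → Bool) (col : ι' → Fin n ⊕ Fin n' → Bool)
    (D Φ : Matrix ι ι' K) (lam : ℕ)
    (hΦ : ∀ x y, colourI (row x) ≠ colourI (col y) → Φ x y = 0)
    (hcut : ∀ B' : Finset (Fin n' → Bool),
      (Matrix.of fun x y => if colourJ (row x) ∈ B' ∧ colourJ (col y) ∉ B' then (D + Φ) x y else 0).rank ≤ lam) :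
    ∃ L : Matrix ι ι' K, L.rank ≤ 8 * lam ∧
      ∀ x y, colourI (row x) ≠ colourI (col y) → colourJ (row x) ≠ colourJ (col y) → L x y = D x y := by
  classical
  obtain ⟨B₀, L, -, hrank, hagree⟩ := exists_completion_le_four_jmaxcut row col (D + Φ)
  -- the reverse-direction block of `B₀` is the directed block of its complement
  have hrev : (Matrix.of fun x y => if colourJ (row x) ∉ B₀ ∧ colourJ (col y) ∈ B₀ then (D + Φ) x y else 0) =
      (Matrix.of fun x y => if colourJ (row x) ∈ (univ \ B₀) ∧ colourJ (col y) ∉ (univ \ B₀) then (D + Φ) x y else 0) := by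
    ext x y
    simp only [Matrix.of_apply, mem_sdiff, mem_univ, true_and, not_not]
  refine ⟨L, hrank.trans ?_, fun x y hI hJ => ?_⟩
  · have h1 := hcut B₀
    have h2 := hcut (univ \ B₀)
    rw [← hrev] at h2
    omega
  · rw [hagree x y hJ, Matrix.add_apply, hΦ x y hI, add_zero]

/-- **Completion ⟹ SIMCORR.**  A completion `L` of rank `≤ λ` gives the I-diagonal correction `Φ := (L − D) ∘ 1[I-colours agree,
J-colours differ]`, for which every directed J-cut block of `D + Φ` is a zero-padded submatrix of `L`, of rank `≤ λ`. -/
theorem simCorr_of_completion (row : ι → Fin n ⊕ Fin n' → Bool) (col : ι' → Fin n ⊕ Fin n' → Bool)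
    (D L : Matrix ι ι' K) (lam : ℕ) (hL : L.rank ≤ lam)
    (hagree : ∀ x y, colourI (row x) ≠ colourI (col y) → colourJ (row x) ≠ colourJ (col y) → L x y = D x y) :
    ∃ Φ : Matrix ι ι' K, (∀ x y, colourI (row x) ≠ colourI (col y) → Φ x y = 0) ∧
      ∀ B' : Finset (Fin n' → Bool),
        (Matrix.of fun x y => if colourJ (row x) ∈ B' ∧ colourJ (col y) ∉ B' then (D + Φ) x y else 0).rank ≤ lam := by
  classical
  refine ⟨Matrix.of fun x y => if colourI (row x) = colourI (col y) ∧ colourJ (row x) ≠ colourJ (col y) then L x y - D x y else 0,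
    fun x y h => by simp [Matrix.of_apply, h], fun B' => ?_⟩
  have hblock : (Matrix.of fun x y => if colourJ (row x) ∈ B' ∧ colourJ (col y) ∉ B' then
      (D + Matrix.of fun x y => if colourI (row x) = colourI (col y) ∧ colourJ (row x) ≠ colourJ (col y)
        then L x y - D x y else 0) x y else 0) =
      (Matrix.of fun x y => if colourJ (row x) ∈ B' ∧ colourJ (col y) ∉ B' then L x y else 0) := by
    ext x y
    simp only [Matrix.of_apply, Matrix.add_apply]
    by_cases h : colourJ (row x) ∈ B' ∧ colourJ (col y) ∉ B'
    · rw [if_pos h, if_pos h]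
      have hJ : colourJ (row x) ≠ colourJ (col y) := fun e => h.2 (e ▸ h.1)
      by_cases hI : colourI (row x) = colourI (col y)
      · rw [if_pos ⟨hI, hJ⟩]; ring
      · rw [if_neg (fun h' => hI h'.1), add_zero, hagree x y hI hJ]
    · rw [if_neg h, if_neg h]
  rw [hblock]
  exact (rank_mask_le (fun x => colourJ (row x) ∈ B') (fun y => colourJ (col y) ∉ B') L).trans hL

end Summit.PneNP.PneNP.Theorems.CnfIdealGenLengthRankDefectRepresentationsSimultaneousCorrection
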